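import Literature.Computability.Complexity.CHModArith
import Literature.Computability.Complexity.CRRFacts
import HarnessLib

/-!
# Primes, generators and discrete logarithms inside the counting hierarchy

Sixth toolkit file (theorems only) of the scaled-up `FOM + MAJ` calculus: the number-theoretic
predicates of Hesse–Allender–Barrington's Step 2 (JCSS 65 (2002), §4: "deciding whether a short
number is prime is in FO … there is an `FO + POW` formula `GEN(g, p)` stating that `g` is the
smallest generator of `ℤₚ*` … `GEN(g, p) ∧ POW(g, i, a, p)` stating that `i` is the discrete
logarithm of `a`"), scaled up to `CH` exactly as in Bürgisser's proof of Thm. 3.7 (ECCC TR06-113,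
p. 12: "We can find the smallest generator `g` of the cyclic group `F_p^×` in `PH` … the discrete
logarithm … in `P^NP` … definable in `CH`"):

* `primeVal_mem_CH`: `{w | val w is prime} ∈ CH` (a `∀` over trial divisors);
* `genTest_mem_CH`: the order test `0 < g < m ∧ ∀ 0 < e < m-1, gᵉ ≢ 1 (mod m)` on `⟨m, g⟩`;
* `leastGenGraph_mem_CH`: the graph of `m ↦` least generator of `(ℤ/m)ˣ` (`m` prime; `0` else);
* `dlogGraph_mem_CH`: the graph of the discrete logarithm `(m, b) ↦ log_g (b mod m)` to that base
  (`0` when `m` is not prime or `m ∣ b`), with its specification `pow_dlog_mod_eq`.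

The functions are written with `Nat.find` on decidable predicates (`exists_genTest`,
`exists_dlog`) so that no definitions are introduced.

## References

* W. Hesse, E. Allender, D. A. M. Barrington, JCSS 65 (2002), §4 (Steps 1–2).
* P. Bürgisser, ECCC TR06-113 (2006), proof of Thm. 3.7.
-/

namespace Literature.Computability.Complexity

open _root_.Computability Polynomial PRelSigma TTClosure Brick PPSharpP ThresholdPP Plumb Finset

/-! ### Small `P` atoms with constants -/

/-- `{w | c ≤ val w} ∈ P` for a constant `c`. [folklore] -/
theorem constLeVal_mem_P (c : ℕ) : ({w | c ≤ bitsToNat w} : Language Bool) ∈ Classes.P :=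
  mem_P_of_iff (preimage_mem_P leVal_mem_P (pairFn_mem_FP (const_mem_FP (encodeNat c)) OracleCompose.id_mem_FP)) _
    fun w => by
      change _ ↔ bitsToNat (fstP (pairFn (fun _ => encodeNat c) id w)) ≤ bitsToNat (sndP (pairFn (fun _ => encodeNat c) id w))
      rw [pairFn_apply, fstP_boolPair, sndP_boolPair, bitsToNat_encodeNat]; rfl

/-- `{w | val w = c} ∈ P` for a constant `c`. [folklore] -/
theorem valEqConst_mem_P (c : ℕ) : ({w | bitsToNat w = c} : Language Bool) ∈ Classes.P :=
  mem_P_of_iff (preimage_mem_P eqVal_mem_P (pairFn_mem_FP OracleCompose.id_mem_FP (const_mem_FP (encodeNat c)))) _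
    fun w => by
      change _ ↔ bitsToNat (fstP (pairFn id (fun _ => encodeNat c) w)) = bitsToNat (sndP (pairFn id (fun _ => encodeNat c) w))
      rw [pairFn_apply, fstP_boolPair, sndP_boolPair, bitsToNat_encodeNat]; rfl

/-- `{⟨a, b⟩ | val a mod val b = 0} ∈ P` (divisibility `val b ∣ val a`). [folklore] -/
theorem modZero_mem_P : ({u | bitsToNat (fstP u) % bitsToNat (sndP u) = 0} : Language Bool) ∈ Classes.P :=
  mem_P_of_iff (preimage_mem_P modGraph_mem_P (pairFn_mem_FP (pairFn_mem_FP fstP_mem_FP sndP_mem_FP) (const_mem_FP []))) _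
    fun u => by
      change _ ↔ bitsToNat (fstP (fstP (pairFn (pairFn fstP sndP) (fun _ => []) u))) %
          bitsToNat (sndP (fstP (pairFn (pairFn fstP sndP) (fun _ => []) u))) =
        bitsToNat (sndP (pairFn (pairFn fstP sndP) (fun _ => []) u))
      rw [pairFn_apply, pairFn_apply, fstP_boolPair, sndP_boolPair, fstP_boolPair, sndP_boolPair, bitsToNat_nil]; rfl

/-! ### Primality -/

/-- **Primality of a numeral is a `CH` predicate** (indeed `coNP`): `val w` is prime iff
`2 ≤ val w` and every `d < 2^{|w|}` dividing it is `1` or `val w` (HAB 2002, §4: "deciding whether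
a short number is prime is in FO", scaled). [cite: HesseAllenderBarrington2002, §4] -/
theorem primeVal_mem_CH : ({w | (bitsToNat w).Prime} : Language Bool) ∈ CH := by
  -- `D = {⟨w, d⟩ | val w mod val d = 0 → val d = 1 ∨ val d = val w}`
  have hD : (({u | bitsToNat (fstP u) % bitsToNat (sndP u) = 0} : Language Bool)ᶜ ⊔
      ((sndP ⁻¹' ({w | bitsToNat w = 1} : Language Bool)) ⊔
        (pairFn sndP fstP ⁻¹' ({u | bitsToNat (fstP u) = bitsToNat (sndP u)} : Language Bool)))) ∈ Classes.P :=
    union_mem_P ((compl_mem_P_iff).2 modZero_mem_P) (union_mem_P (preimage_mem_P (valEqConst_mem_P 1) sndP_mem_FP)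
      (preimage_mem_P eqVal_mem_P (pairFn_mem_FP sndP_mem_FP fstP_mem_FP)))
  have hB := forall_lt_mem_CH (P_subset_CH hD) X
  refine mem_CH_of_iff (inter_P_mem_CH (constLeVal_mem_P 2) hB) _ fun w => ?_
  rw [memL_inf']
  change (bitsToNat w).Prime ↔ 2 ≤ bitsToNat w ∧ ∀ v < 2 ^ (X : Polynomial ℕ).eval w.length,
    ¬ bitsToNat (fstP (boolPair w (encodeNat v))) % bitsToNat (sndP (boolPair w (encodeNat v))) = 0 ∨
      (bitsToNat (sndP (boolPair w (encodeNat v))) = 1 ∨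
        bitsToNat (fstP (pairFn sndP fstP (boolPair w (encodeNat v)))) =
          bitsToNat (sndP (pairFn sndP fstP (boolPair w (encodeNat v)))))
  simp only [fstP_boolPair, sndP_boolPair, pairFn_apply, bitsToNat_encodeNat]
  rw [Nat.prime_def]
  constructor
  · rintro ⟨h2, h⟩
    refine ⟨h2, fun v _ => ?_⟩
    rw [← Nat.dvd_iff_mod_eq_zero, or_iff_not_imp_left, not_not]
    exact h v
  · rintro ⟨h2, h⟩
    refine ⟨h2, fun m hm => ?_⟩
    have hmle : m ≤ bitsToNat w := Nat.le_of_dvd (by omega) hm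
    rcases h m (hmle.trans_lt (val_lt_two_pow_eval_X w)) with h1 | h1
    · exact absurd (Nat.mod_eq_zero_of_dvd hm) h1
    · exact h1

/-! ### The order test for generators -/

/-- The modular power as a total function of `(g, e, m)` (value `0` for `m ≤ 1`); for `2 ≤ m` it is
`gᵉ mod m`. [folklore] -/
theorem powMod_eq_of_two_le {g e m : ℕ} (hm : 2 ≤ m) : (if m ≤ 1 then 0 else g ^ e % m) = g ^ e % m := by
  rw [if_neg (by omega)]

/-- **The order test is a `CH` predicate**: on `u = ⟨m, g⟩`,
`0 < val g < val m ∧ ∀ e < val m - 1, 0 < e → (val g)ᵉ mod val m ≠ 1` (a `∀` over the `P` atom of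
modular exponentiation; HAB 2002, §4, formula `GEN`). [cite: HesseAllenderBarrington2002, §4] -/
theorem genTest_mem_CH :
    ({u | 0 < bitsToNat (sndP u) ∧ bitsToNat (sndP u) < bitsToNat (fstP u) ∧
      ∀ e < bitsToNat (fstP u) - 1, 0 < e → bitsToNat (sndP u) ^ e % bitsToNat (fstP u) ≠ 1} : Language Bool) ∈ CH := by
  -- inner language on `w = ⟨u, e⟩`: `val e = 0 ∨ ¬ val e < val m - 1 ∨ ¬ pm(g, e, m) = 1`
  have hE0 : (sndP ⁻¹' ({w | bitsToNat w = 0} : Language Bool)) ∈ Classes.P := preimage_mem_P valZero_mem_P sndP_mem_FP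
  have hLt : (pairFn sndP (subFn ∘ pairFn (fstP ∘ fstP) (fun _ => encodeNat 1)) ⁻¹'
      ({u | bitsToNat (fstP u) < bitsToNat (sndP u)} : Language Bool)) ∈ Classes.P :=
    preimage_mem_P ltVal_mem_P (pairFn_mem_FP sndP_mem_FP (comp_mem_FP subFn_mem_FP
      (pairFn_mem_FP (comp_mem_FP fstP_mem_FP fstP_mem_FP) (const_mem_FP _))))
  have hPM : (pairFn (pairFn (sndP ∘ fstP) (pairFn sndP (fstP ∘ fstP))) (fun _ => encodeNat 1) ⁻¹'
      ({z | (if bitsToNat (sndP (sndP (fstP z))) ≤ 1 then 0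
        else bitsToNat (fstP (fstP z)) ^ bitsToNat (fstP (sndP (fstP z))) % bitsToNat (sndP (sndP (fstP z)))) =
        bitsToNat (sndP z)} : Language Bool)) ∈ Classes.P :=
    preimage_mem_P powModGraph_mem_P (pairFn_mem_FP (pairFn_mem_FP (comp_mem_FP sndP_mem_FP fstP_mem_FP)
      (pairFn_mem_FP sndP_mem_FP (comp_mem_FP fstP_mem_FP fstP_mem_FP))) (const_mem_FP _))
  have hInner := union_mem_P hE0 (union_mem_P ((compl_mem_P_iff).2 hLt) ((compl_mem_P_iff).2 hPM))
  have hAll := forall_lt_mem_CH (P_subset_CH hInner) X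
  have hPos : ({u | 0 < bitsToNat (sndP u)} : Language Bool) ∈ Classes.P :=
    mem_P_of_iff ((compl_mem_P_iff).2 (preimage_mem_P valZero_mem_P sndP_mem_FP)) _ fun u => by
      rw [memL_compl]
      change _ ↔ ¬ bitsToNat (sndP u) = 0
      exact Nat.pos_iff_ne_zero
  refine mem_CH_of_iff (inter_P_mem_CH hPos (inter_P_mem_CH gtVal_mem_P hAll)) _ fun u => ?_
  rw [memL_inf', memL_inf']
  change _ ↔ 0 < bitsToNat (sndP u) ∧ bitsToNat (sndP u) < bitsToNat (fstP u) ∧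
    ∀ v < 2 ^ (X : Polynomial ℕ).eval u.length,
      bitsToNat (sndP (boolPair u (encodeNat v))) = 0 ∨
        (¬ bitsToNat (fstP (pairFn sndP (subFn ∘ pairFn (fstP ∘ fstP) (fun _ => encodeNat 1)) (boolPair u (encodeNat v)))) <
            bitsToNat (sndP (pairFn sndP (subFn ∘ pairFn (fstP ∘ fstP) (fun _ => encodeNat 1)) (boolPair u (encodeNat v)))) ∨
          ¬ (if bitsToNat (sndP (sndP (fstP (pairFn (pairFn (sndP ∘ fstP) (pairFn sndP (fstP ∘ fstP))) (fun _ => encodeNat 1)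
              (boolPair u (encodeNat v)))))) ≤ 1 then 0
            else bitsToNat (fstP (fstP (pairFn (pairFn (sndP ∘ fstP) (pairFn sndP (fstP ∘ fstP))) (fun _ => encodeNat 1)
              (boolPair u (encodeNat v))))) ^
              bitsToNat (fstP (sndP (fstP (pairFn (pairFn (sndP ∘ fstP) (pairFn sndP (fstP ∘ fstP))) (fun _ => encodeNat 1)
                (boolPair u (encodeNat v)))))) %
              bitsToNat (sndP (sndP (fstP (pairFn (pairFn (sndP ∘ fstP) (pairFn sndP (fstP ∘ fstP))) (fun _ => encodeNat 1)
                (boolPair u (encodeNat v))))))) =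
            bitsToNat (sndP (pairFn (pairFn (sndP ∘ fstP) (pairFn sndP (fstP ∘ fstP))) (fun _ => encodeNat 1)
              (boolPair u (encodeNat v)))))
  simp only [pairFn_apply, Function.comp_apply, fstP_boolPair, sndP_boolPair, subFn_boolPair, bitsToNat_encodeNat]
  refine and_congr Iff.rfl (and_congr Iff.rfl ⟨fun h v _ => ?_, fun h e he hpos => ?_⟩)
  · by_cases hv0 : v = 0
    · exact Or.inl hv0
    · by_cases hvlt : v < bitsToNat (fstP u) - 1
      · refine Or.inr (Or.inr ?_)
        have h2 : 2 ≤ bitsToNat (fstP u) := by omega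
        rw [if_neg (by omega)]
        exact h v hvlt (Nat.pos_of_ne_zero hv0)
      · exact Or.inr (Or.inl hvlt)
  · have h2 : 2 ≤ bitsToNat (fstP u) := by omega
    have herange : e < 2 ^ (X : Polynomial ℕ).eval u.length :=
      lt_trans he ((Nat.sub_lt (by omega) Nat.one_pos).trans ((val_lt_two_pow_eval_X (fstP u)).trans_le
        (Nat.pow_le_pow_right (by norm_num) (by rw [eval_X, eval_X]; exact length_fstP_le u))))
    rcases h e herange with h1 | h1 | h1
    · omega
    · exact absurd he h1
    · rwa [if_neg (by omega)] at h1

/-! ### The least generator -/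

section Gen

/-- The order test, as a decidable predicate on `g`. [folklore] -/
theorem exists_genTest {m : ℕ} (hm : m.Prime) :
    ∃ g, 0 < g ∧ g < m ∧ ∀ e < m - 1, 0 < e → g ^ e % m ≠ 1 := by
  obtain ⟨g, h0, hlt, hord⟩ := exists_generator_mod_prime hm
  exact ⟨g, h0, hlt, fun e he hpos => hord e hpos he⟩

/-- The least generator passes the order test (with the hypotheses in the order of `CRRFacts`). [folklore] -/
theorem leastGen_spec {m : ℕ} (hm : m.Prime) :
    0 < Nat.find (exists_genTest hm) ∧ Nat.find (exists_genTest hm) < m ∧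
      ∀ e, 0 < e → e < m - 1 → Nat.find (exists_genTest hm) ^ e % m ≠ 1 := by
  obtain ⟨h0, hlt, hord⟩ := Nat.find_spec (exists_genTest hm)
  exact ⟨h0, hlt, fun e hpos he => hord e he hpos⟩

/-- The least-generator function `m ↦ (if m prime then least g passing the order test else 0)` is
below `m` (and `0` at non-primes), hence `< 2^{|w|}` on numerals. [folklore] -/
theorem leastGen_lt_two_pow (w : List Bool) :
    (if h : (bitsToNat w).Prime then Nat.find (exists_genTest h) else 0) < 2 ^ (X : Polynomial ℕ).eval w.length := by
  split_ifs with h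
  · exact (leastGen_spec h).2.1.trans (val_lt_two_pow_eval_X w)
  · exact Nat.two_pow_pos _

/-- **The graph of the least generator is in `CH`**: on `u = ⟨m, g⟩`, "`val g` is the least
generator of `(ℤ/val m)ˣ` if `val m` is prime, and `0` otherwise" — the order test, its negation
for all smaller candidates, and primality (HAB 2002, §4: "there is clearly an `FO + POW` formula
`GEN(g, p)` stating that `g` is the smallest generator"; Bürgisser 2006, p. 12: "in `PH`"). [cite: HesseAllenderBarrington2002, §4] -/
theorem leastGenGraph_mem_CH :
    {u | (if h : (bitsToNat (fstP u)).Prime then Nat.find (exists_genTest h) else 0) = bitsToNat (sndP u)} ∈ CH := by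
  have hPr : fstP ⁻¹' ({w | (bitsToNat w).Prime} : Language Bool) ∈ CH := preimage_mem_CH primeVal_mem_CH fstP_mem_FP
  have hGT := genTest_mem_CH
  -- minimality: `∀ g' < val g, ¬ genTest (m, g')`
  have hGT' := preimage_mem_CH genTest_mem_CH (pairFn_mem_FP (comp_mem_FP fstP_mem_FP fstP_mem_FP) sndP_mem_FP)
  have hLt : (pairFn sndP (sndP ∘ fstP) ⁻¹' ({u | bitsToNat (fstP u) < bitsToNat (sndP u)} : Language Bool)) ∈ Classes.P :=
    preimage_mem_P ltVal_mem_P (pairFn_mem_FP sndP_mem_FP (comp_mem_FP sndP_mem_FP fstP_mem_FP))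
  have hMin := forall_lt_mem_CH (union_mem_CH (P_subset_CH ((compl_mem_P_iff).2 hLt)) (compl_mem_CH hGT')) X
  have hZ : sndP ⁻¹' ({w | bitsToNat w = 0} : Language Bool) ∈ Classes.P := preimage_mem_P valZero_mem_P sndP_mem_FP
  refine mem_CH_of_iff (union_mem_CH (inter_mem_CH hPr (inter_mem_CH hGT hMin)) (inter_P_mem_CH hZ (compl_mem_CH hPr))) _
    fun u => ?_
  rw [memL_sup, memL_inf', memL_inf', memL_inf', memL_compl]
  change (if h : (bitsToNat (fstP u)).Prime then Nat.find (exists_genTest h) else 0) = bitsToNat (sndP u) ↔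
    ((bitsToNat (fstP u)).Prime ∧
      (0 < bitsToNat (sndP u) ∧ bitsToNat (sndP u) < bitsToNat (fstP u) ∧
        ∀ e < bitsToNat (fstP u) - 1, 0 < e → bitsToNat (sndP u) ^ e % bitsToNat (fstP u) ≠ 1) ∧
      ∀ v < 2 ^ (X : Polynomial ℕ).eval u.length,
        ¬ bitsToNat (fstP (pairFn sndP (sndP ∘ fstP) (boolPair u (encodeNat v)))) <
            bitsToNat (sndP (pairFn sndP (sndP ∘ fstP) (boolPair u (encodeNat v)))) ∨
          ¬ (0 < bitsToNat (sndP (pairFn (fstP ∘ fstP) sndP (boolPair u (encodeNat v)))) ∧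
              bitsToNat (sndP (pairFn (fstP ∘ fstP) sndP (boolPair u (encodeNat v)))) <
                bitsToNat (fstP (pairFn (fstP ∘ fstP) sndP (boolPair u (encodeNat v)))) ∧
              ∀ e < bitsToNat (fstP (pairFn (fstP ∘ fstP) sndP (boolPair u (encodeNat v)))) - 1, 0 < e →
                bitsToNat (sndP (pairFn (fstP ∘ fstP) sndP (boolPair u (encodeNat v)))) ^ e %
                  bitsToNat (fstP (pairFn (fstP ∘ fstP) sndP (boolPair u (encodeNat v)))) ≠ 1)) ∨
    bitsToNat (sndP u) = 0 ∧ ¬ (bitsToNat (fstP u)).Prime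
  simp only [pairFn_apply, Function.comp_apply, fstP_boolPair, sndP_boolPair, bitsToNat_encodeNat]
  by_cases hpr : (bitsToNat (fstP u)).Prime
  · rw [dif_pos hpr]
    simp only [hpr, true_and, not_true_eq_false, and_false, or_false]
    rw [Nat.find_eq_iff]
    refine and_congr Iff.rfl ⟨fun h v _ => ?_, fun h g' hg' => ?_⟩
    · by_cases hv : v < bitsToNat (sndP u)
      · exact Or.inr (h v hv)
      · exact Or.inl hv
    · have hv : g' < 2 ^ (X : Polynomial ℕ).eval u.length :=
        hg'.trans ((val_lt_two_pow_eval_X (sndP u)).trans_le (Nat.pow_le_pow_right (by norm_num)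
          (by rw [eval_X, eval_X]; exact (Nat.le_add_left _ _).trans (length_components_le' u))))
      rcases h g' hv with h1 | h1
      · exact absurd hg' h1
      · exact h1
  · rw [dif_neg hpr]
    simp only [hpr, false_and, false_or, not_false_eq_true, and_true]
    exact eq_comm
where
  /-- `|fstP u| + |sndP u| ≤ |u|`. [folklore] -/
  length_components_le' (u : List Bool) : (fstP u).length + (sndP u).length ≤ u.length := by
    have a := length_fstF_sndF_le u
    change 2 * (fstP u).length + (sndP u).length ≤ _ at a
    omega

end Gen

/-! ### The discrete logarithm -/

section Dlog

/-- Existence of discrete logarithms to the least generator, as a decidable predicate. [cite: HesseAllenderBarrington2002, §4] -/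
theorem exists_dlog {m b : ℕ} (h : m.Prime ∧ b % m ≠ 0) :
    ∃ e, e < m - 1 ∧ Nat.find (exists_genTest h.1) ^ e % m = b % m := by
  obtain ⟨h0, hlt, hord⟩ := leastGen_spec h.1
  obtain ⟨e, he, heq⟩ := exists_pow_mod_eq_of_forall_pow_ne_one h.1 h0 hlt hord
    (Nat.pos_of_ne_zero h.2) (Nat.mod_lt _ h.1.pos)
  exact ⟨e, he, heq⟩

/-- **Specification of the discrete logarithm**: `g^{dlog(m, b)} ≡ b (mod m)` and `dlog < m - 1`
for `m` prime, `m ∤ b`, `g` the least generator. [cite: HesseAllenderBarrington2002, §4] -/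
theorem pow_dlog_mod_eq {m b : ℕ} (h : m.Prime ∧ b % m ≠ 0) :
    Nat.find (exists_dlog h) < m - 1 ∧ Nat.find (exists_genTest h.1) ^ Nat.find (exists_dlog h) % m = b % m :=
  Nat.find_spec (exists_dlog h)

/-- The discrete logarithm is characterised by its defining congruence (uniqueness of `dlog`). [cite: HesseAllenderBarrington2002, §4] -/
theorem dlog_eq_iff {m b : ℕ} (h : m.Prime ∧ b % m ≠ 0) (e : ℕ) :
    Nat.find (exists_dlog h) = e ↔ e < m - 1 ∧ Nat.find (exists_genTest h.1) ^ e % m = b % m := by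
  constructor
  · rintro rfl; exact pow_dlog_mod_eq h
  · rintro ⟨he, heq⟩
    obtain ⟨h0, hlt, hord⟩ := leastGen_spec h.1
    obtain ⟨hd, hdeq⟩ := pow_dlog_mod_eq h
    exact pow_mod_injOn h.1 h0 hlt hord hd he (hdeq.trans heq.symm)

/-- The discrete-logarithm function `(m, b) ↦ dlog` (value `0` off its domain) is `< m`, hence
`< 2^{|w|}` on words `w = ⟨m, b⟩`. [folklore] -/
theorem dlog_lt_two_pow (w : List Bool) :
    (if h : (bitsToNat (fstP w)).Prime ∧ bitsToNat (sndP w) % bitsToNat (fstP w) ≠ 0 then Nat.find (exists_dlog h) else 0) <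
      2 ^ (X : Polynomial ℕ).eval w.length := by
  split_ifs with h
  · refine lt_of_lt_of_le (pow_dlog_mod_eq h).1 ((Nat.sub_le _ _).trans ((val_lt_two_pow_eval_X (fstP w)).le.trans
      (Nat.pow_le_pow_right (by norm_num) (by rw [eval_X, eval_X]; exact length_fstP_le w))))
  · exact Nat.two_pow_pos _

/-- **The graph of the discrete logarithm is in `CH`**: on `z = ⟨⟨m, b⟩, e⟩`, "`val e` is the
discrete logarithm of `val b` modulo the prime `val m` to the least generator (and `0` off the
domain)" — substitute the least generator (`leastGenGraph_mem_CH`) into the `P` atom of modular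
exponentiation (HAB 2002, §4: "`GEN(g, p) ∧ POW(g, i, a, p)` stating that `i` is the discrete
logarithm of `a`"; Bürgisser 2006, p. 12: "in `P^NP` … definable in `CH`"). [cite: HesseAllenderBarrington2002, §4] -/
theorem dlogGraph_mem_CH :
    {z | (if h : (bitsToNat (fstP (fstP z))).Prime ∧ bitsToNat (sndP (fstP z)) % bitsToNat (fstP (fstP z)) ≠ 0
        then Nat.find (exists_dlog h) else 0) = bitsToNat (sndP z)} ∈ CH := by
  -- the atom `R = {⟨bin γ, z⟩ | γ^{val e} mod val m = val b mod val m}` (with the `m ≤ 1` convention of `powMod`)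
  have hR : (pairFn (pairFn fstP (pairFn (sndP ∘ sndP) (fstP ∘ fstP ∘ sndP))) (remFn ∘ pairFn (sndP ∘ fstP ∘ sndP) (fstP ∘ fstP ∘ sndP)) ⁻¹'
      ({z | (if bitsToNat (sndP (sndP (fstP z))) ≤ 1 then 0
        else bitsToNat (fstP (fstP z)) ^ bitsToNat (fstP (sndP (fstP z))) % bitsToNat (sndP (sndP (fstP z)))) =
        bitsToNat (sndP z)} : Language Bool)) ∈ Classes.P :=
    preimage_mem_P powModGraph_mem_P (pairFn_mem_FP (pairFn_mem_FP fstP_mem_FP (pairFn_mem_FP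
      (comp_mem_FP sndP_mem_FP sndP_mem_FP) (comp_mem_FP fstP_mem_FP (comp_mem_FP fstP_mem_FP sndP_mem_FP))))
      (comp_mem_FP remFn_mem_FP (pairFn_mem_FP (comp_mem_FP sndP_mem_FP (comp_mem_FP fstP_mem_FP sndP_mem_FP))
        (comp_mem_FP fstP_mem_FP (comp_mem_FP fstP_mem_FP sndP_mem_FP)))))
  -- substitute the least generator of `val m`, `m = fstP (fstP z)`
  have hSub := rel_apply_mem_CH (P_subset_CH hR)
    (f := fun x => if h : (bitsToNat x).Prime then Nat.find (exists_genTest h) else 0)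
    (mem_CH_of_iff leastGenGraph_mem_CH _ fun u => Iff.rfl) leastGen_lt_two_pow (comp_mem_FP fstP_mem_FP fstP_mem_FP)
  -- the domain conditions and the range condition `val e < val m - 1`
  have hPr : (fstP ∘ fstP) ⁻¹' ({w | (bitsToNat w).Prime} : Language Bool) ∈ CH :=
    preimage_mem_CH primeVal_mem_CH (comp_mem_FP fstP_mem_FP fstP_mem_FP)
  have hNZ : ({u | bitsToNat (sndP (fstP u)) % bitsToNat (fstP (fstP u)) ≠ 0} : Language Bool) ∈ Classes.P :=
    mem_P_of_iff ((compl_mem_P_iff).2 (preimage_mem_P modZero_mem_P (pairFn_mem_FP (comp_mem_FP sndP_mem_FP fstP_mem_FP)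
      (comp_mem_FP fstP_mem_FP fstP_mem_FP)))) _ fun u => by
      rw [memL_compl]
      change _ ↔ ¬ bitsToNat (fstP (pairFn (sndP ∘ fstP) (fstP ∘ fstP) u)) % bitsToNat (sndP (pairFn (sndP ∘ fstP) (fstP ∘ fstP) u)) = 0
      rw [pairFn_apply, fstP_boolPair, sndP_boolPair]; rfl
  have hLt : (pairFn sndP (subFn ∘ pairFn (fstP ∘ fstP) (fun _ => encodeNat 1)) ⁻¹'
      ({u | bitsToNat (fstP u) < bitsToNat (sndP u)} : Language Bool)) ∈ Classes.P :=
    preimage_mem_P ltVal_mem_P (pairFn_mem_FP sndP_mem_FP (comp_mem_FP subFn_mem_FP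
      (pairFn_mem_FP (comp_mem_FP fstP_mem_FP fstP_mem_FP) (const_mem_FP _))))
  have hZ : sndP ⁻¹' ({w | bitsToNat w = 0} : Language Bool) ∈ Classes.P := preimage_mem_P valZero_mem_P sndP_mem_FP
  have hDom := inter_P_mem_CH hNZ hPr
  refine mem_CH_of_iff (union_mem_CH (inter_mem_CH hDom (inter_P_mem_CH hLt hSub)) (inter_P_mem_CH hZ (compl_mem_CH hDom))) _
    fun z => ?_
  simp only [memL_sup, memL_inf', memL_compl]
  change (if h : (bitsToNat (fstP (fstP z))).Prime ∧ bitsToNat (sndP (fstP z)) % bitsToNat (fstP (fstP z)) ≠ 0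
      then Nat.find (exists_dlog h) else 0) = bitsToNat (sndP z) ↔
    ((bitsToNat (sndP (fstP z)) % bitsToNat (fstP (fstP z)) ≠ 0 ∧
        (bitsToNat ((fstP ∘ fstP) z)).Prime) ∧
      bitsToNat (fstP (pairFn sndP (subFn ∘ pairFn (fstP ∘ fstP) (fun _ => encodeNat 1)) z)) <
          bitsToNat (sndP (pairFn sndP (subFn ∘ pairFn (fstP ∘ fstP) (fun _ => encodeNat 1)) z)) ∧
        (if bitsToNat (sndP (sndP (fstP (pairFn (pairFn fstP (pairFn (sndP ∘ sndP) (fstP ∘ fstP ∘ sndP)))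
            (remFn ∘ pairFn (sndP ∘ fstP ∘ sndP) (fstP ∘ fstP ∘ sndP))
            (boolPair (encodeNat ((fun x => if h : (bitsToNat x).Prime then Nat.find (exists_genTest h) else 0)
              ((fstP ∘ fstP) z))) z))))) ≤ 1 then 0
          else bitsToNat (fstP (fstP (pairFn (pairFn fstP (pairFn (sndP ∘ sndP) (fstP ∘ fstP ∘ sndP)))
            (remFn ∘ pairFn (sndP ∘ fstP ∘ sndP) (fstP ∘ fstP ∘ sndP))
            (boolPair (encodeNat ((fun x => if h : (bitsToNat x).Prime then Nat.find (exists_genTest h) else 0)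
              ((fstP ∘ fstP) z))) z)))) ^
            bitsToNat (fstP (sndP (fstP (pairFn (pairFn fstP (pairFn (sndP ∘ sndP) (fstP ∘ fstP ∘ sndP)))
              (remFn ∘ pairFn (sndP ∘ fstP ∘ sndP) (fstP ∘ fstP ∘ sndP))
              (boolPair (encodeNat ((fun x => if h : (bitsToNat x).Prime then Nat.find (exists_genTest h) else 0)
                ((fstP ∘ fstP) z))) z))))) %
            bitsToNat (sndP (sndP (fstP (pairFn (pairFn fstP (pairFn (sndP ∘ sndP) (fstP ∘ fstP ∘ sndP)))
              (remFn ∘ pairFn (sndP ∘ fstP ∘ sndP) (fstP ∘ fstP ∘ sndP))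
              (boolPair (encodeNat ((fun x => if h : (bitsToNat x).Prime then Nat.find (exists_genTest h) else 0)
                ((fstP ∘ fstP) z))) z)))))) =
          bitsToNat (sndP (pairFn (pairFn fstP (pairFn (sndP ∘ sndP) (fstP ∘ fstP ∘ sndP)))
            (remFn ∘ pairFn (sndP ∘ fstP ∘ sndP) (fstP ∘ fstP ∘ sndP))
            (boolPair (encodeNat ((fun x => if h : (bitsToNat x).Prime then Nat.find (exists_genTest h) else 0)
              ((fstP ∘ fstP) z))) z)))) ∨
    bitsToNat (sndP z) = 0 ∧ ¬ (bitsToNat (sndP (fstP z)) % bitsToNat (fstP (fstP z)) ≠ 0 ∧ (bitsToNat ((fstP ∘ fstP) z)).Prime)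
  simp only [pairFn_apply, Function.comp_apply, fstP_boolPair, sndP_boolPair, subFn_boolPair, remFn_boolPair,
    bitsToNat_encodeNat]
  by_cases hdom : (bitsToNat (fstP (fstP z))).Prime ∧ bitsToNat (sndP (fstP z)) % bitsToNat (fstP (fstP z)) ≠ 0
  · rw [dif_pos hdom, dif_pos hdom.1, if_neg (by have := hdom.1.two_le; omega), dlog_eq_iff hdom]
    have h1 := hdom.1
    have h2 := hdom.2
    tauto
  · rw [dif_neg hdom]
    have he : (0 = bitsToNat (sndP z)) ↔ (bitsToNat (sndP z) = 0) := eq_comm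
    have hd' : ¬ (bitsToNat (sndP (fstP z)) % bitsToNat (fstP (fstP z)) ≠ 0 ∧ (bitsToNat (fstP (fstP z))).Prime) :=
      fun h' => hdom ⟨h'.2, h'.1⟩
    tauto

end Dlog

end Literature.Computability.Complexity
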